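import Summits.BirchSwinnertonDyer.BirchSwinnertonDyer.Theorems.SignedLowerHalvesSmallImageLowerHalfBothSignsRttJunctionShaLayerMaps
import Literature.NumberTheory.GaloisCohomology.ShaRestrictedLayerToSelmer
import Literature.NumberTheory.EllipticCurves.PeriodIndexCorestrictionLocal
import HarnessLib

/-!
# Route `SignedLowerHalves`, crux L `SmallImageLowerHalfBothSigns` (stmt-BirchSwinnertonDyer-23599), line `rtt_w3` v35 — stub S3α″ (`stub_junctionShaPi_ns`),
# brick α5′-3a: THE COMPARISON MAPS `ι_{n,k} : Ш¹_P(K_n, A[p^k]) → H¹(K_∞, A)` — restriction to `K_∞` after the coefficient inclusion `A[p^k] ⊆ A` — and their laws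

INPUTS hand `bsd-inputs-honda-p1` g29 under LEAD `cruxlead-stmt-BirchSwinnertonDyer-23599` (cell `bsd-ssimc`); helper `--supports stmt-BirchSwinnertonDyer-23599`.
DEFINITIONS WITH BODIES (`iotaO`, `iotaLayerO`) + THEOREMS; no named fact, no instance, no `sorry`. For an ABSTRACT discrete `Γ_K`-module `A = M` with open
stabilisers (-w3's `torsRep M hstab p k` on `A[p^k] = torsionPow M p k`) and a `ℤ_p`-extension `κ` (`K_∞ = K̄^{ker κ}`, layers `U_n = κ.layerSubgroup n`):
* `iotaO n k : Ш¹_P(K_n, A[p^k]) →+ H¹(Gal(K̄/K_∞), A)` = the tree's `ShaLayer.toSubgroupH1 P (torsRep …) (A[p^k] ⊆ A) (ker κ ≤ U_n)` on the `Ш¹`-layer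
  (`layerShaRestricted P (torsRep M hstab p k) (U_n) 1`), and its layer form `iotaLayerO n k : Ш¹_P(K_n, A[p^k]) →+ H¹(U_n, A)` with
  `resOfLe (ker κ ≤ U_n) ∘ iotaLayerO = iotaO` (`resOfLe_iotaLayerO`) — the shape in which membership in `Sel(K_∞) = ⋃_n res(Sel(K_n))` is checked;
* the laws of the socket `…RttJunctionShaSocket`: `iotaO_resYO` (restriction, `toSubgroupH1_resLe`), `iotaO_inclYO` (coefficient inclusion, `toSubgroupH1_cohomologyMap`),
  `iotaO_conjYO` / `iotaLayerO_conjYO` (conjugation `conj_δ`, `toSubgroupH1_conjMap`).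
The sequel bricks: membership of `iotaO z` in lambda-p1's `strictSelmer` (local triviality ⟹ saturated signed condition and unramifiedness, all conjugates), the kernel
property (`IotaKernelProperty`), and the plug `A := Cofree θ F`.
HONEST FRAMING: cohomological bookkeeping; α5′, S3α″, crux L and BSD are NOT proved here and remain OPEN; BSD is proved for NO curve.
References: [SerreGaloisCohomology1997] I §2.4–2.5, I §5.1; [SerreLocalFields1979] VII §5 Prop. 3; [MilneADT2006] I §4 (p. 56); [JohnsonLeungKings2011] §5.4 Lemma 5.8
(arXiv p0015:L150–165).
-/

set_option autoImplicit false
set_option linter.dupNamespace false -- D-0017: single-problem summit, the namespace repeats the problem name by design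
noncomputable section

open scoped Classical
open NumberField IsDedekindDomain Field Function CategoryTheory

namespace Summit.BirchSwinnertonDyer.BirchSwinnertonDyer.Theorems.SmallImageRttJunctionSha

open Literature.NumberTheory.EllipticCurves Literature.NumberTheory.GaloisRepresentations
  Literature.NumberTheory.GaloisRepresentations.DiscreteGaloisModule Literature.NumberTheory.GaloisCohomology Literature.NumberTheory.GaloisCohomology.ShaLayer
  Summit.BirchSwinnertonDyer.BirchSwinnertonDyer.Theorems.SmallImageRttD2Seq

section Iota

variable {K : Type} [Field K] [NumberField K] {p : ℕ} [Fact p.Prime] (κ : ZpExtension K p) (P : Set (HeightOneSpectrum (𝓞 K)))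
  (M : Type) [AddCommGroup M] [DistribMulAction (absoluteGaloisGroup K) M] [TopologicalSpace M] [DiscreteTopology M]
  (hstab : ∀ m : M, IsOpen (MulAction.stabilizer (absoluteGaloisGroup K) m : Set (absoluteGaloisGroup K)))

omit [NumberField K] [Fact p.Prime] in
/-- The coefficient inclusion `A[p^k] ⊆ A` is `Γ_K`-equivariant (definitional). [folklore] -/
theorem torsionPow_subtype_equivariant (k : ℕ) (σ : absoluteGaloisGroup K) (m : ↥(torsionPow M p k)) :
    (torsionPow M p k).subtype (torsRep M hstab p k σ m) = σ • (torsionPow M p k).subtype m := rfl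

/-- ★ **`ι_{n,k} : Ш¹_P(K_n, A[p^k]) → H¹(Gal(K̄/K_∞), A)`** — restriction to `K_∞` after the coefficient inclusion `A[p^k] ⊆ A` (the tree's `ShaLayer.toSubgroupH1` along
`ker κ ≤ U_n`, on the `Ш¹`-layer). [cite: JohnsonLeungKings2011, §5.4 Lemma 5.8 (arXiv p0015:L150–165)] [cite: SerreGaloisCohomology1997, I §2.4–2.5] -/
def iotaO (n k : ℕ) : ↥(layerShaRestricted P (torsRep M hstab p k) (κ.layerSubgroup n) 1) →+ subgroupH1 κ.kerSubgroup M :=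
  (ShaLayer.toSubgroupH1 P (torsRep M hstab p k) (torsionPow M p k).subtype (torsionPow_subtype_equivariant M hstab k) (κ.kerSubgroup_le_layerSubgroup n)).comp
    (layerShaRestricted P (torsRep M hstab p k) (κ.layerSubgroup n) 1).subtype

/-- Unfolding `iotaO`. [cite: SerreGaloisCohomology1997, I §2.4] -/
theorem iotaO_apply (n k : ℕ) (z : ↥(layerShaRestricted P (torsRep M hstab p k) (κ.layerSubgroup n) 1)) :
    iotaO κ P M hstab n k z =
      ShaLayer.toSubgroupH1 P (torsRep M hstab p k) (torsionPow M p k).subtype (torsionPow_subtype_equivariant M hstab k) (κ.kerSubgroup_le_layerSubgroup n) z.1 := rfl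

/-- **The layer form `Ш¹_P(K_n, A[p^k]) → H¹(U_n, A)`** (inflation to `U_n` with the coefficient inclusion; `ShaLayer.toSubgroupH1` along `U_n ≤ U_n`).
[cite: SerreGaloisCohomology1997, I §2.4–2.5] -/
def iotaLayerO (n k : ℕ) : ↥(layerShaRestricted P (torsRep M hstab p k) (κ.layerSubgroup n) 1) →+ subgroupH1 (κ.layerSubgroup n) M :=
  (ShaLayer.toSubgroupH1 P (torsRep M hstab p k) (torsionPow M p k).subtype (torsionPow_subtype_equivariant M hstab k) (le_refl (κ.layerSubgroup n))).comp
    (layerShaRestricted P (torsRep M hstab p k) (κ.layerSubgroup n) 1).subtype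

/-- Unfolding `iotaLayerO`. [cite: SerreGaloisCohomology1997, I §2.4] -/
theorem iotaLayerO_apply (n k : ℕ) (z : ↥(layerShaRestricted P (torsRep M hstab p k) (κ.layerSubgroup n) 1)) :
    iotaLayerO κ P M hstab n k z =
      ShaLayer.toSubgroupH1 P (torsRep M hstab p k) (torsionPow M p k).subtype (torsionPow_subtype_equivariant M hstab k) (le_refl (κ.layerSubgroup n)) z.1 := rfl

/-- **`res_{K_∞/K_n} ∘ ι^{layer}_{n,k} = ι_{n,k}`** (on cocycles both are `h ↦ c(π h)`). [cite: SerreGaloisCohomology1997, I §2.5] -/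
theorem resOfLe_iotaLayerO (n k : ℕ) (z : ↥(layerShaRestricted P (torsRep M hstab p k) (κ.layerSubgroup n) 1)) :
    resOfLe M (κ.kerSubgroup_le_layerSubgroup n) (iotaLayerO κ P M hstab n k z) = iotaO κ P M hstab n k z := by
  obtain ⟨c, hc⟩ := oneCocycleClass_surjective _ z.1
  rw [iotaLayerO_apply, iotaO_apply, ← hc, ShaLayer.toSubgroupH1_oneCocycleClass, ShaLayer.toSubgroupH1_oneCocycleClass, resOfLe,
    resH1Hom_oneCocycleClass]
  exact congrArg (oneCocycleClass _) (Subtype.ext (ContinuousMap.ext fun _ ↦ rfl))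

variable (hNP : ∀ n : ℕ, ramificationSubgroup K P ≤ κ.layerSubgroup n) (hA : ∀ k : ℕ, ramificationSubgroup K P ≤ ContinuousRep.ker (torsRep M hstab p k))

/-- **Law (res)**: `ι_{n+1,k} ∘ res = ι_{n,k}` (`toSubgroupH1_resLe`). [cite: SerreGaloisCohomology1997, I §2.5] -/
theorem iotaO_resYO (n k : ℕ) (z : ↥(layerShaRestricted P (torsRep M hstab p k) (κ.layerSubgroup n) 1)) :
    iotaO κ P M hstab (n + 1) k (resYO κ P M hstab hNP hA n k z) = iotaO κ P M hstab n k z := by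
  rw [iotaO_apply, iotaO_apply, coe_resYO]
  exact ShaLayer.toSubgroupH1_resLe P (torsRep M hstab p k) _ _ (κ.kerSubgroup_le_layerSubgroup (n + 1)) (κ.layerSubgroup_antitone (Nat.le_succ n)) z.1

/-- **Law (incl)**: `ι_{n,k+1} ∘ incl = ι_{n,k}` (`toSubgroupH1_cohomologyMap` along -w3's `torsInclHom`). [cite: SerreGaloisCohomology1997, I §2.4] -/
theorem iotaO_inclYO (n k : ℕ) (z : ↥(layerShaRestricted P (torsRep M hstab p k) (κ.layerSubgroup n) 1)) :
    iotaO κ P M hstab n (k + 1) (inclYO κ P M hstab hNP hA n k z) = iotaO κ P M hstab n k z := by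
  rw [iotaO_apply, iotaO_apply, coe_inclYO]
  exact ShaLayer.toSubgroupH1_cohomologyMap P (torsRep M hstab p k) _ (torsionPow_subtype_equivariant M hstab k) (torsRep M hstab p (k + 1)) _
    (torsionPow_subtype_equivariant M hstab (k + 1)) (torsInclHom M hstab (p := p) (Nat.le_succ k)) (fun _ ↦ rfl) (κ.kerSubgroup_le_layerSubgroup n) z.1

/-- **Law (conj)**: `ι_{n,k} (conj_δ z) = conjH1 δ (ι_{n,k} z)` for every `δ ∈ Γ_K` (`toSubgroupH1_conjMap`). [cite: SerreLocalFields1979, VII §5 Prop. 3] -/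
theorem iotaO_conjYO (n k : ℕ) (δ : absoluteGaloisGroup K) (z : ↥(layerShaRestricted P (torsRep M hstab p k) (κ.layerSubgroup n) 1)) :
    iotaO κ P M hstab n k (conjYO κ P M hstab n k δ z) = conjH1 κ.kerSubgroup M δ (iotaO κ P M hstab n k z) := by
  haveI : κ.kerSubgroup.Normal := MonoidHom.normal_ker _
  rw [iotaO_apply, iotaO_apply, coe_conjYO, layerConj_apply]
  exact ShaLayer.toSubgroupH1_conjMap P (torsRep M hstab p k) _ _ (κ.kerSubgroup_le_layerSubgroup n) δ z.1

/-- **Law (conj), layer form**: `ι^{layer}_{n,k} (conj_δ z) = conjH1 δ (ι^{layer}_{n,k} z)`. [cite: SerreLocalFields1979, VII §5 Prop. 3] -/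
theorem iotaLayerO_conjYO (n k : ℕ) (δ : absoluteGaloisGroup K) (z : ↥(layerShaRestricted P (torsRep M hstab p k) (κ.layerSubgroup n) 1)) :
    iotaLayerO κ P M hstab n k (conjYO κ P M hstab n k δ z) = conjH1 (κ.layerSubgroup n) M δ (iotaLayerO κ P M hstab n k z) := by
  rw [iotaLayerO_apply, iotaLayerO_apply, coe_conjYO, layerConj_apply]
  exact ShaLayer.toSubgroupH1_conjMap P (torsRep M hstab p k) _ _ (le_refl (κ.layerSubgroup n)) δ z.1

end Iota

end Summit.BirchSwinnertonDyer.BirchSwinnertonDyer.Theorems.SmallImageRttJunctionSha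

end
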